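import Mathlib.Tactic.Ring
import Mathlib.Tactic.Linarith
import Mathlib.Tactic.Positivity
import Mathlib.Tactic.LinearCombination
import Mathlib.Data.Real.Basic
import Summits.HodgeConjecture.HodgeConjecture.Theorems.WeilClassTestFormatFiveThreeProductFormula
import HarnessLib

/-!
# Conjecture N (hodge-weil ladder, GAPS G51b/G51c), format (5,3): the extreme pair `(F₁, F₃)` and the DOUBLY-ONE-SIDED CLASS AT SMALL TILT

Prover 2, generation 15 (note `run/shared/lean/b2b/hodge-weil/b2b-hweil-pv2-g15/DIVIDED-DIFFERENCE-G15.md` §2.2–2.3, ADDENDUM 1). Setting of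
`CONJECTURE-N.md` §1 in format (5,3) (E-roots `(A_e,u_e)`, F-roots `(B_g,v_g)`, centred coordinates; `Q₂`, `Q₄`, purity sums `P1, P2, P4`; pairwise
ampleness). With `K_j(g) := [y^j]∏_e((u_e − v_g) + y(A_e − B_g))` (g13's coefficients) and the Leibniz divided difference `M₁₃` of the pair `(F₁,F₃)`
(`WeilClassTestFormatFiveThreeProductFormula.lean`, there written for the pair `(F₁,F₂)`; here instantiated with the roots `2 ↔ 3` exchanged):
* `pair13_coeff0/1/2` — the exact coefficient identities `δ·[y⁰]M₁₃ = K₀(1) − K₀(3)`, `δ·[y¹]M₁₃ + Δ·[y⁰]M₁₃ = K₁(1) − K₁(3)`,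
  `δ·[y²]M₁₃ + Δ·[y¹]M₁₃ = K₂(1) − K₂(3)` (`δ := v₃ − v₁`, `Δ := B₃ − B₁`; from `(w₃ − w₁)·M₁₃ = Π₁ − Π₃`);
* `Glam_delta_cubed_13` — on the pure locus `δ³·(Q₂ + λQ₄) = 2·(Ψ_λ(1) − Ψ_λ(3))`, `Ψ_λ(g) := δ²K₂(g) − δΔK₁(g) + (Δ² − 6λδ²)K₀(g)`
  (the 'pair formula' `G_λ/2 = τγ₁₃ − K₂[1,3] + 6λσ` of the note, cleared of denominators; `γ₁₃ = Δ/δ` is the TILT of the segment `F₁F₃`);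
* `psi_low_nonneg`, `psi_high_nonneg` — for an F-root weakly BELOW (resp. ABOVE) all E-charges, `Ψ_{4/3}` is a nonnegative (resp. nonpositive)
  combination of products once `Δ² + 2δ² ≥ 5|Δ|δ` and `|Δ| ≤ 4δ`, i.e. once the tilt satisfies `|γ₁₃| ≤ (5 − √17)/2`
  (`e₂(m) − γe₁(m) + γ² − 8 = (γ² − 5γ + 2) + (4 − γ)Σ(m_e − 1) + e₂(m − 1)` for inverse slopes `m_e ≥ 1`);
* **`conjectureN_53_doublyOneSided_smallTilt`** — THEOREM: every centred, pure, pairwise-ample real (5,3) configuration whose E-charges all lie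
  between the charges of two F-roots `F₁, F₃` (`v₁ ≤ u_e ≤ v₃`, the DOUBLY-ONE-SIDED class, which contains pv2-g9's extremal cross configuration) and
  whose tilt is small, `(B₃−B₁)² + 2(v₃−v₁)² ≥ 5|B₃−B₁|(v₃−v₁)`, `|B₃−B₁| ≤ 4(v₃−v₁)`, satisfies `Q₂ + (4/3)Q₄ ≥ 0` — the first piece of the
  `Q₄ < 0` half of Conjecture N in format (5,3) (the third root `F₂` is not used beyond purity; for larger tilts the collinearity constraint on `F₂`'s
  charge is needed: LEMMA DOS of the note, ADDENDUM 1).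
Pure algebra; nothing here is a case of HC, a rung or a door edge; no statement of Markman's papers is used. New cell result ⇒ Summits/.
-/

set_option linter.dupNamespace false

open Summit.HodgeConjecture.HodgeConjecture.WeilClassTestFormatFiveThreeProductFormula

namespace Summit.HodgeConjecture.HodgeConjecture.WeilClassTestFormatFiveThreeDoublyOneSided

/-- `δ·[y⁰]M₁₃ = K₀(1) − K₀(3)` for the pair `(F₁,F₃)` (`δ = v₃ − v₁`). -/
theorem pair13_coeff0 (u₁ u₂ u₃ u₄ u₅ v₁ v₃ : ℝ) :
    (v₃ - v₁) * ((u₂ - v₃) * (u₃ - v₃) * (u₄ - v₃) * (u₅ - v₃)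
          + (u₁ - v₁) * (u₃ - v₃) * (u₄ - v₃) * (u₅ - v₃)
          + (u₁ - v₁) * (u₂ - v₁) * (u₄ - v₃) * (u₅ - v₃)
          + (u₁ - v₁) * (u₂ - v₁) * (u₃ - v₁) * (u₅ - v₃)
          + (u₁ - v₁) * (u₂ - v₁) * (u₃ - v₁) * (u₄ - v₁))
      = (((u₁ - v₁) * (u₂ - v₁) * (u₃ - v₁) * (u₄ - v₁) * (u₅ - v₁)) - ((u₁ - v₃) * (u₂ - v₃) * (u₃ - v₃) * (u₄ - v₃) * (u₅ - v₃))) := by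
  ring

/-- `δ·[y¹]M₁₃ + Δ·[y⁰]M₁₃ = K₁(1) − K₁(3)` for the pair `(F₁,F₃)` (`δ = v₃ − v₁`, `Δ = B₃ − B₁`). -/
theorem pair13_coeff1 (A₁ A₂ A₃ A₄ A₅ B₁ B₃ u₁ u₂ u₃ u₄ u₅ v₁ v₃ : ℝ) :
    (v₃ - v₁) * ((A₂ - B₃) * (u₃ - v₃) * (u₄ - v₃) * (u₅ - v₃)
          + (u₂ - v₃) * (A₃ - B₃) * (u₄ - v₃) * (u₅ - v₃)
          + (u₂ - v₃) * (u₃ - v₃) * (A₄ - B₃) * (u₅ - v₃)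
          + (u₂ - v₃) * (u₃ - v₃) * (u₄ - v₃) * (A₅ - B₃)
          + (A₁ - B₁) * (u₃ - v₃) * (u₄ - v₃) * (u₅ - v₃)
          + (u₁ - v₁) * (A₃ - B₃) * (u₄ - v₃) * (u₅ - v₃)
          + (u₁ - v₁) * (u₃ - v₃) * (A₄ - B₃) * (u₅ - v₃)
          + (u₁ - v₁) * (u₃ - v₃) * (u₄ - v₃) * (A₅ - B₃)
          + (A₁ - B₁) * (u₂ - v₁) * (u₄ - v₃) * (u₅ - v₃)
          + (u₁ - v₁) * (A₂ - B₁) * (u₄ - v₃) * (u₅ - v₃)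
          + (u₁ - v₁) * (u₂ - v₁) * (A₄ - B₃) * (u₅ - v₃)
          + (u₁ - v₁) * (u₂ - v₁) * (u₄ - v₃) * (A₅ - B₃)
          + (A₁ - B₁) * (u₂ - v₁) * (u₃ - v₁) * (u₅ - v₃)
          + (u₁ - v₁) * (A₂ - B₁) * (u₃ - v₁) * (u₅ - v₃)
          + (u₁ - v₁) * (u₂ - v₁) * (A₃ - B₁) * (u₅ - v₃)
          + (u₁ - v₁) * (u₂ - v₁) * (u₃ - v₁) * (A₅ - B₃)
          + (A₁ - B₁) * (u₂ - v₁) * (u₃ - v₁) * (u₄ - v₁)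
          + (u₁ - v₁) * (A₂ - B₁) * (u₃ - v₁) * (u₄ - v₁)
          + (u₁ - v₁) * (u₂ - v₁) * (A₃ - B₁) * (u₄ - v₁)
          + (u₁ - v₁) * (u₂ - v₁) * (u₃ - v₁) * (A₄ - B₁))
      + (B₃ - B₁) * ((u₂ - v₃) * (u₃ - v₃) * (u₄ - v₃) * (u₅ - v₃)
          + (u₁ - v₁) * (u₃ - v₃) * (u₄ - v₃) * (u₅ - v₃)
          + (u₁ - v₁) * (u₂ - v₁) * (u₄ - v₃) * (u₅ - v₃)
          + (u₁ - v₁) * (u₂ - v₁) * (u₃ - v₁) * (u₅ - v₃)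
          + (u₁ - v₁) * (u₂ - v₁) * (u₃ - v₁) * (u₄ - v₁))
      = (((A₁ - B₁) * (u₂ - v₁) * (u₃ - v₁) * (u₄ - v₁) * (u₅ - v₁) + (A₂ - B₁) * (u₁ - v₁) * (u₃ - v₁) * (u₄ - v₁) * (u₅ - v₁) + (A₃ - B₁) * (u₁ - v₁) * (u₂ - v₁) * (u₄ - v₁) * (u₅ - v₁) + (A₄ - B₁) * (u₁ - v₁) * (u₂ - v₁) * (u₃ - v₁) * (u₅ - v₁) + (A₅ - B₁) * (u₁ - v₁) * (u₂ - v₁) * (u₃ - v₁) * (u₄ - v₁))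
        - ((A₁ - B₃) * (u₂ - v₃) * (u₃ - v₃) * (u₄ - v₃) * (u₅ - v₃) + (A₂ - B₃) * (u₁ - v₃) * (u₃ - v₃) * (u₄ - v₃) * (u₅ - v₃) + (A₃ - B₃) * (u₁ - v₃) * (u₂ - v₃) * (u₄ - v₃) * (u₅ - v₃) + (A₄ - B₃) * (u₁ - v₃) * (u₂ - v₃) * (u₃ - v₃) * (u₅ - v₃) + (A₅ - B₃) * (u₁ - v₃) * (u₂ - v₃) * (u₃ - v₃) * (u₄ - v₃))) := by
  ring

/-- `δ·[y²]M₁₃ + Δ·[y¹]M₁₃ = K₂(1) − K₂(3)` for the pair `(F₁,F₃)`. -/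
theorem pair13_coeff2 (A₁ A₂ A₃ A₄ A₅ B₁ B₃ u₁ u₂ u₃ u₄ u₅ v₁ v₃ : ℝ) :
    (v₃ - v₁) * ((A₂ - B₃) * (A₃ - B₃) * (u₄ - v₃) * (u₅ - v₃)
          + (A₂ - B₃) * (u₃ - v₃) * (A₄ - B₃) * (u₅ - v₃)
          + (A₂ - B₃) * (u₃ - v₃) * (u₄ - v₃) * (A₅ - B₃)
          + (u₂ - v₃) * (A₃ - B₃) * (A₄ - B₃) * (u₅ - v₃)
          + (u₂ - v₃) * (A₃ - B₃) * (u₄ - v₃) * (A₅ - B₃)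
          + (u₂ - v₃) * (u₃ - v₃) * (A₄ - B₃) * (A₅ - B₃)
          + (A₁ - B₁) * (A₃ - B₃) * (u₄ - v₃) * (u₅ - v₃)
          + (A₁ - B₁) * (u₃ - v₃) * (A₄ - B₃) * (u₅ - v₃)
          + (A₁ - B₁) * (u₃ - v₃) * (u₄ - v₃) * (A₅ - B₃)
          + (u₁ - v₁) * (A₃ - B₃) * (A₄ - B₃) * (u₅ - v₃)
          + (u₁ - v₁) * (A₃ - B₃) * (u₄ - v₃) * (A₅ - B₃)
          + (u₁ - v₁) * (u₃ - v₃) * (A₄ - B₃) * (A₅ - B₃)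
          + (A₁ - B₁) * (A₂ - B₁) * (u₄ - v₃) * (u₅ - v₃)
          + (A₁ - B₁) * (u₂ - v₁) * (A₄ - B₃) * (u₅ - v₃)
          + (A₁ - B₁) * (u₂ - v₁) * (u₄ - v₃) * (A₅ - B₃)
          + (u₁ - v₁) * (A₂ - B₁) * (A₄ - B₃) * (u₅ - v₃)
          + (u₁ - v₁) * (A₂ - B₁) * (u₄ - v₃) * (A₅ - B₃)
          + (u₁ - v₁) * (u₂ - v₁) * (A₄ - B₃) * (A₅ - B₃)
          + (A₁ - B₁) * (A₂ - B₁) * (u₃ - v₁) * (u₅ - v₃)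
          + (A₁ - B₁) * (u₂ - v₁) * (A₃ - B₁) * (u₅ - v₃)
          + (A₁ - B₁) * (u₂ - v₁) * (u₃ - v₁) * (A₅ - B₃)
          + (u₁ - v₁) * (A₂ - B₁) * (A₃ - B₁) * (u₅ - v₃)
          + (u₁ - v₁) * (A₂ - B₁) * (u₃ - v₁) * (A₅ - B₃)
          + (u₁ - v₁) * (u₂ - v₁) * (A₃ - B₁) * (A₅ - B₃)
          + (A₁ - B₁) * (A₂ - B₁) * (u₃ - v₁) * (u₄ - v₁)
          + (A₁ - B₁) * (u₂ - v₁) * (A₃ - B₁) * (u₄ - v₁)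
          + (A₁ - B₁) * (u₂ - v₁) * (u₃ - v₁) * (A₄ - B₁)
          + (u₁ - v₁) * (A₂ - B₁) * (A₃ - B₁) * (u₄ - v₁)
          + (u₁ - v₁) * (A₂ - B₁) * (u₃ - v₁) * (A₄ - B₁)
          + (u₁ - v₁) * (u₂ - v₁) * (A₃ - B₁) * (A₄ - B₁))
      + (B₃ - B₁) * ((A₂ - B₃) * (u₃ - v₃) * (u₄ - v₃) * (u₅ - v₃)
          + (u₂ - v₃) * (A₃ - B₃) * (u₄ - v₃) * (u₅ - v₃)
          + (u₂ - v₃) * (u₃ - v₃) * (A₄ - B₃) * (u₅ - v₃)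
          + (u₂ - v₃) * (u₃ - v₃) * (u₄ - v₃) * (A₅ - B₃)
          + (A₁ - B₁) * (u₃ - v₃) * (u₄ - v₃) * (u₅ - v₃)
          + (u₁ - v₁) * (A₃ - B₃) * (u₄ - v₃) * (u₅ - v₃)
          + (u₁ - v₁) * (u₃ - v₃) * (A₄ - B₃) * (u₅ - v₃)
          + (u₁ - v₁) * (u₃ - v₃) * (u₄ - v₃) * (A₅ - B₃)
          + (A₁ - B₁) * (u₂ - v₁) * (u₄ - v₃) * (u₅ - v₃)
          + (u₁ - v₁) * (A₂ - B₁) * (u₄ - v₃) * (u₅ - v₃)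
          + (u₁ - v₁) * (u₂ - v₁) * (A₄ - B₃) * (u₅ - v₃)
          + (u₁ - v₁) * (u₂ - v₁) * (u₄ - v₃) * (A₅ - B₃)
          + (A₁ - B₁) * (u₂ - v₁) * (u₃ - v₁) * (u₅ - v₃)
          + (u₁ - v₁) * (A₂ - B₁) * (u₃ - v₁) * (u₅ - v₃)
          + (u₁ - v₁) * (u₂ - v₁) * (A₃ - B₁) * (u₅ - v₃)
          + (u₁ - v₁) * (u₂ - v₁) * (u₃ - v₁) * (A₅ - B₃)
          + (A₁ - B₁) * (u₂ - v₁) * (u₃ - v₁) * (u₄ - v₁)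
          + (u₁ - v₁) * (A₂ - B₁) * (u₃ - v₁) * (u₄ - v₁)
          + (u₁ - v₁) * (u₂ - v₁) * (A₃ - B₁) * (u₄ - v₁)
          + (u₁ - v₁) * (u₂ - v₁) * (u₃ - v₁) * (A₄ - B₁))
      = (((A₁ - B₁) * (A₂ - B₁) * (u₃ - v₁) * (u₄ - v₁) * (u₅ - v₁)
        + (A₁ - B₁) * (A₃ - B₁) * (u₂ - v₁) * (u₄ - v₁) * (u₅ - v₁)
        + (A₁ - B₁) * (A₄ - B₁) * (u₂ - v₁) * (u₃ - v₁) * (u₅ - v₁)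
        + (A₁ - B₁) * (A₅ - B₁) * (u₂ - v₁) * (u₃ - v₁) * (u₄ - v₁)
        + (A₂ - B₁) * (A₃ - B₁) * (u₁ - v₁) * (u₄ - v₁) * (u₅ - v₁)
        + (A₂ - B₁) * (A₄ - B₁) * (u₁ - v₁) * (u₃ - v₁) * (u₅ - v₁)
        + (A₂ - B₁) * (A₅ - B₁) * (u₁ - v₁) * (u₃ - v₁) * (u₄ - v₁)
        + (A₃ - B₁) * (A₄ - B₁) * (u₁ - v₁) * (u₂ - v₁) * (u₅ - v₁)
        + (A₃ - B₁) * (A₅ - B₁) * (u₁ - v₁) * (u₂ - v₁) * (u₄ - v₁)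
        + (A₄ - B₁) * (A₅ - B₁) * (u₁ - v₁) * (u₂ - v₁) * (u₃ - v₁))
        - ((A₁ - B₃) * (A₂ - B₃) * (u₃ - v₃) * (u₄ - v₃) * (u₅ - v₃)
        + (A₁ - B₃) * (A₃ - B₃) * (u₂ - v₃) * (u₄ - v₃) * (u₅ - v₃)
        + (A₁ - B₃) * (A₄ - B₃) * (u₂ - v₃) * (u₃ - v₃) * (u₅ - v₃)
        + (A₁ - B₃) * (A₅ - B₃) * (u₂ - v₃) * (u₃ - v₃) * (u₄ - v₃)
        + (A₂ - B₃) * (A₃ - B₃) * (u₁ - v₃) * (u₄ - v₃) * (u₅ - v₃)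
        + (A₂ - B₃) * (A₄ - B₃) * (u₁ - v₃) * (u₃ - v₃) * (u₅ - v₃)
        + (A₂ - B₃) * (A₅ - B₃) * (u₁ - v₃) * (u₃ - v₃) * (u₄ - v₃)
        + (A₃ - B₃) * (A₄ - B₃) * (u₁ - v₃) * (u₂ - v₃) * (u₅ - v₃)
        + (A₃ - B₃) * (A₅ - B₃) * (u₁ - v₃) * (u₂ - v₃) * (u₄ - v₃)
        + (A₄ - B₃) * (A₅ - B₃) * (u₁ - v₃) * (u₂ - v₃) * (u₃ - v₃))) := by
  ring

/-- THE PAIR FORMULA FOR `(F₁,F₃)`, cleared of denominators: on the pure locus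
`(v₃−v₁)³·(Q₂ + λQ₄) = 2·(Ψ_λ(1) − Ψ_λ(3))`, `Ψ_λ(g) = δ²K₂(g) − δΔK₁(g) + (Δ² − 6λδ²)K₀(g)` (`δ = v₃−v₁`, `Δ = B₃−B₁`). -/
theorem Glam_delta_cubed_13 (A₁ A₂ A₃ A₄ A₅ B₁ B₂ B₃ u₁ u₂ u₃ u₄ u₅ v₁ v₂ v₃ : ℝ)
    (hA : A₁ + A₂ + A₃ + A₄ + A₅ = B₁ + B₂ + B₃) (hC : u₁ + u₂ + u₃ + u₄ + u₅ = v₁ + v₂ + v₃)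
    (hP1 : (A₁ ^ 2 * u₁ + A₂ ^ 2 * u₂ + A₃ ^ 2 * u₃ + A₄ ^ 2 * u₄ + A₅ ^ 2 * u₅) - (B₁ ^ 2 * v₁ + B₂ ^ 2 * v₂ + B₃ ^ 2 * v₃) = 0)
    (hP2 : (A₁ * u₁ ^ 2 + A₂ * u₂ ^ 2 + A₃ * u₃ ^ 2 + A₄ * u₄ ^ 2 + A₅ * u₅ ^ 2) - (B₁ * v₁ ^ 2 + B₂ * v₂ ^ 2 + B₃ * v₃ ^ 2) = 0)
    (hP4 : (u₁ ^ 3 + u₂ ^ 3 + u₃ ^ 3 + u₄ ^ 3 + u₅ ^ 3) - (v₁ ^ 3 + v₂ ^ 3 + v₃ ^ 3) = 0)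
    (l : ℝ) :
    (v₃ - v₁) ^ 3 * ((1 / 2) * ((A₁ ^ 2 + A₂ ^ 2 + A₃ ^ 2 + A₄ ^ 2 + A₅ ^ 2) - (B₁ ^ 2 + B₂ ^ 2 + B₃ ^ 2)) * ((u₁ ^ 2 + u₂ ^ 2 + u₃ ^ 2 + u₄ ^ 2 + u₅ ^ 2) - (v₁ ^ 2 + v₂ ^ 2 + v₃ ^ 2))
        + ((A₁ * u₁ + A₂ * u₂ + A₃ * u₃ + A₄ * u₄ + A₅ * u₅) - (B₁ * v₁ + B₂ * v₂ + B₃ * v₃)) ^ 2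
        - 3 * ((A₁ ^ 2 * u₁ ^ 2 + A₂ ^ 2 * u₂ ^ 2 + A₃ ^ 2 * u₃ ^ 2 + A₄ ^ 2 * u₄ ^ 2 + A₅ ^ 2 * u₅ ^ 2) - (B₁ ^ 2 * v₁ ^ 2 + B₂ ^ 2 * v₂ ^ 2 + B₃ ^ 2 * v₃ ^ 2))
      + l * (3 * ((u₁ ^ 4 + u₂ ^ 4 + u₃ ^ 4 + u₄ ^ 4 + u₅ ^ 4) - (v₁ ^ 4 + v₂ ^ 4 + v₃ ^ 4)) - (3 / 2) * ((u₁ ^ 2 + u₂ ^ 2 + u₃ ^ 2 + u₄ ^ 2 + u₅ ^ 2) - (v₁ ^ 2 + v₂ ^ 2 + v₃ ^ 2)) ^ 2))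
      = 2 * (((v₃ - v₁) ^ 2 * ((A₁ - B₁) * (A₂ - B₁) * (u₃ - v₁) * (u₄ - v₁) * (u₅ - v₁)
        + (A₁ - B₁) * (A₃ - B₁) * (u₂ - v₁) * (u₄ - v₁) * (u₅ - v₁)
        + (A₁ - B₁) * (A₄ - B₁) * (u₂ - v₁) * (u₃ - v₁) * (u₅ - v₁)
        + (A₁ - B₁) * (A₅ - B₁) * (u₂ - v₁) * (u₃ - v₁) * (u₄ - v₁)
        + (A₂ - B₁) * (A₃ - B₁) * (u₁ - v₁) * (u₄ - v₁) * (u₅ - v₁)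
        + (A₂ - B₁) * (A₄ - B₁) * (u₁ - v₁) * (u₃ - v₁) * (u₅ - v₁)
        + (A₂ - B₁) * (A₅ - B₁) * (u₁ - v₁) * (u₃ - v₁) * (u₄ - v₁)
        + (A₃ - B₁) * (A₄ - B₁) * (u₁ - v₁) * (u₂ - v₁) * (u₅ - v₁)
        + (A₃ - B₁) * (A₅ - B₁) * (u₁ - v₁) * (u₂ - v₁) * (u₄ - v₁)
        + (A₄ - B₁) * (A₅ - B₁) * (u₁ - v₁) * (u₂ - v₁) * (u₃ - v₁))
        - (v₃ - v₁) * (B₃ - B₁) * ((A₁ - B₁) * (u₂ - v₁) * (u₃ - v₁) * (u₄ - v₁) * (u₅ - v₁) + (A₂ - B₁) * (u₁ - v₁) * (u₃ - v₁) * (u₄ - v₁) * (u₅ - v₁) + (A₃ - B₁) * (u₁ - v₁) * (u₂ - v₁) * (u₄ - v₁) * (u₅ - v₁) + (A₄ - B₁) * (u₁ - v₁) * (u₂ - v₁) * (u₃ - v₁) * (u₅ - v₁) + (A₅ - B₁) * (u₁ - v₁) * (u₂ - v₁) * (u₃ - v₁) * (u₄ - v₁))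
        + ((B₃ - B₁) ^ 2 - 6 * l * (v₃ - v₁) ^ 2) * ((u₁ - v₁) * (u₂ - v₁) * (u₃ - v₁) * (u₄ - v₁) * (u₅ - v₁)))
        - ((v₃ - v₁) ^ 2 * ((A₁ - B₃) * (A₂ - B₃) * (u₃ - v₃) * (u₄ - v₃) * (u₅ - v₃)
        + (A₁ - B₃) * (A₃ - B₃) * (u₂ - v₃) * (u₄ - v₃) * (u₅ - v₃)
        + (A₁ - B₃) * (A₄ - B₃) * (u₂ - v₃) * (u₃ - v₃) * (u₅ - v₃)
        + (A₁ - B₃) * (A₅ - B₃) * (u₂ - v₃) * (u₃ - v₃) * (u₄ - v₃)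
        + (A₂ - B₃) * (A₃ - B₃) * (u₁ - v₃) * (u₄ - v₃) * (u₅ - v₃)
        + (A₂ - B₃) * (A₄ - B₃) * (u₁ - v₃) * (u₃ - v₃) * (u₅ - v₃)
        + (A₂ - B₃) * (A₅ - B₃) * (u₁ - v₃) * (u₃ - v₃) * (u₄ - v₃)
        + (A₃ - B₃) * (A₄ - B₃) * (u₁ - v₃) * (u₂ - v₃) * (u₅ - v₃)
        + (A₃ - B₃) * (A₅ - B₃) * (u₁ - v₃) * (u₂ - v₃) * (u₄ - v₃)
        + (A₄ - B₃) * (A₅ - B₃) * (u₁ - v₃) * (u₂ - v₃) * (u₃ - v₃))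
        - (v₃ - v₁) * (B₃ - B₁) * ((A₁ - B₃) * (u₂ - v₃) * (u₃ - v₃) * (u₄ - v₃) * (u₅ - v₃) + (A₂ - B₃) * (u₁ - v₃) * (u₃ - v₃) * (u₄ - v₃) * (u₅ - v₃) + (A₃ - B₃) * (u₁ - v₃) * (u₂ - v₃) * (u₄ - v₃) * (u₅ - v₃) + (A₄ - B₃) * (u₁ - v₃) * (u₂ - v₃) * (u₃ - v₃) * (u₅ - v₃) + (A₅ - B₃) * (u₁ - v₃) * (u₂ - v₃) * (u₃ - v₃) * (u₄ - v₃))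
        + ((B₃ - B₁) ^ 2 - 6 * l * (v₃ - v₁) ^ 2) * ((u₁ - v₃) * (u₂ - v₃) * (u₃ - v₃) * (u₄ - v₃) * (u₅ - v₃)))) := by
  have hG := Glam_eq_dd12 A₁ A₂ A₃ A₄ A₅ B₁ B₃ B₂ u₁ u₂ u₃ u₄ u₅ v₁ v₃ v₂
    (by linarith) (by linarith) (by linarith) (by linarith) (by linarith) l
  have e0 := pair13_coeff0 u₁ u₂ u₃ u₄ u₅ v₁ v₃
  have e1 := pair13_coeff1 A₁ A₂ A₃ A₄ A₅ B₁ B₃ u₁ u₂ u₃ u₄ u₅ v₁ v₃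
  have e2 := pair13_coeff2 A₁ A₂ A₃ A₄ A₅ B₁ B₃ u₁ u₂ u₃ u₄ u₅ v₁ v₃
  linear_combination (v₃ - v₁) ^ 3 * hG + (2 * (v₃ - v₁) ^ 2) * e2 - (2 * (v₃ - v₁) * (B₃ - B₁)) * e1
    + (2 * ((B₃ - B₁) ^ 2 - 6 * l * (v₃ - v₁) ^ 2)) * e0

/-- `Ψ_{4/3} ≥ 0` for an F-root weakly below all E-charges at small tilt: with `b_e ≥ 0` (charge differences), `d_e ≥ 0` (ampleness slacks,
`a_e = b_e + d_e`), `δ ≥ 0`, `Δ² − 5Δδ + 2δ² ≥ 0`, `4δ − Δ ≥ 0`: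
`δ²K₂ − δΔK₁ + (Δ² − 8δ²)K₀ = (Δ² − 5Δδ + 2δ²)∏b + δ(4δ − Δ)Σ_i d_i∏_{k≠i}b_k + δ²Σ_{i<j} d_id_j∏_{k≠i,j}b_k ≥ 0`. -/
theorem psi_low_nonneg (b₁ b₂ b₃ b₄ b₅ d₁ d₂ d₃ d₄ d₅ δ Δ : ℝ)
    (hb₁ : 0 ≤ b₁) (hb₂ : 0 ≤ b₂) (hb₃ : 0 ≤ b₃) (hb₄ : 0 ≤ b₄) (hb₅ : 0 ≤ b₅)
    (hd₁ : 0 ≤ d₁) (hd₂ : 0 ≤ d₂) (hd₃ : 0 ≤ d₃) (hd₄ : 0 ≤ d₄) (hd₅ : 0 ≤ d₅)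
    (hδ : 0 ≤ δ) (h1 : 0 ≤ Δ ^ 2 - 5 * Δ * δ + 2 * δ ^ 2) (h4 : 0 ≤ 4 * δ - Δ) :
    0 ≤ δ ^ 2 * ((b₁ + d₁) * (b₂ + d₂) * b₃ * b₄ * b₅ + (b₁ + d₁) * (b₃ + d₃) * b₂ * b₄ * b₅ + (b₁ + d₁) * (b₄ + d₄) * b₂ * b₃ * b₅ + (b₁ + d₁) * (b₅ + d₅) * b₂ * b₃ * b₄ + (b₂ + d₂) * (b₃ + d₃) * b₁ * b₄ * b₅ + (b₂ + d₂) * (b₄ + d₄) * b₁ * b₃ * b₅ + (b₂ + d₂) * (b₅ + d₅) * b₁ * b₃ * b₄ + (b₃ + d₃) * (b₄ + d₄) * b₁ * b₂ * b₅ + (b₃ + d₃) * (b₅ + d₅) * b₁ * b₂ * b₄ + (b₄ + d₄) * (b₅ + d₅) * b₁ * b₂ * b₃)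
      - δ * Δ * ((b₁ + d₁) * b₂ * b₃ * b₄ * b₅ + (b₂ + d₂) * b₁ * b₃ * b₄ * b₅ + (b₃ + d₃) * b₁ * b₂ * b₄ * b₅ + (b₄ + d₄) * b₁ * b₂ * b₃ * b₅ + (b₅ + d₅) * b₁ * b₂ * b₃ * b₄)
      + (Δ ^ 2 - 8 * δ ^ 2) * (b₁ * b₂ * b₃ * b₄ * b₅) := by
  have e : δ ^ 2 * ((b₁ + d₁) * (b₂ + d₂) * b₃ * b₄ * b₅ + (b₁ + d₁) * (b₃ + d₃) * b₂ * b₄ * b₅ + (b₁ + d₁) * (b₄ + d₄) * b₂ * b₃ * b₅ + (b₁ + d₁) * (b₅ + d₅) * b₂ * b₃ * b₄ + (b₂ + d₂) * (b₃ + d₃) * b₁ * b₄ * b₅ + (b₂ + d₂) * (b₄ + d₄) * b₁ * b₃ * b₅ + (b₂ + d₂) * (b₅ + d₅) * b₁ * b₃ * b₄ + (b₃ + d₃) * (b₄ + d₄) * b₁ * b₂ * b₅ + (b₃ + d₃) * (b₅ + d₅) * b₁ * b₂ * b₄ + (b₄ + d₄) * (b₅ + d₅) * b₁ * b₂ * 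b₃)
      - δ * Δ * ((b₁ + d₁) * b₂ * b₃ * b₄ * b₅ + (b₂ + d₂) * b₁ * b₃ * b₄ * b₅ + (b₃ + d₃) * b₁ * b₂ * b₄ * b₅ + (b₄ + d₄) * b₁ * b₂ * b₃ * b₅ + (b₅ + d₅) * b₁ * b₂ * b₃ * b₄)
      + (Δ ^ 2 - 8 * δ ^ 2) * (b₁ * b₂ * b₃ * b₄ * b₅)
      = (Δ ^ 2 - 5 * Δ * δ + 2 * δ ^ 2) * (b₁ * b₂ * b₃ * b₄ * b₅)
      + δ * (4 * δ - Δ) * (d₁ * b₂ * b₃ * b₄ * b₅ + d₂ * b₁ * b₃ * b₄ * b₅ + d₃ * b₁ * b₂ * b₄ * b₅ + d₄ * b₁ * b₂ * b₃ * b₅ + d₅ * b₁ * b₂ * b₃ * b₄)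
      + δ ^ 2 * (d₁ * d₂ * b₃ * b₄ * b₅ + d₁ * d₃ * b₂ * b₄ * b₅ + d₁ * d₄ * b₂ * b₃ * b₅ + d₁ * d₅ * b₂ * b₃ * b₄ + d₂ * d₃ * b₁ * b₄ * b₅ + d₂ * d₄ * b₁ * b₃ * b₅ + d₂ * d₅ * b₁ * b₃ * b₄ + d₃ * d₄ * b₁ * b₂ * b₅ + d₃ * d₅ * b₁ * b₂ * b₄ + d₄ * d₅ * b₁ * b₂ * b₃) := by ring
  rw [e]
  positivity

/-- `−Ψ_{4/3} ≥ 0` for an F-root weakly above all E-charges at small tilt, in nonnegative form: `c_e = v₃ − u_e ≥ 0`, `d_e ≥ 0` the ampleness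
slacks, `δ ≥ 0`, `Δ² + 5Δδ + 2δ² ≥ 0`, `4δ + Δ ≥ 0` ⟹ `(Δ² + 5Δδ + 2δ²)∏c + δ(4δ + Δ)Σ_i d_i∏_{k≠i}c_k + δ²Σ_{i<j}d_id_j∏c ≥ 0`. -/
theorem psi_high_nonneg (c₁ c₂ c₃ c₄ c₅ d₁ d₂ d₃ d₄ d₅ δ Δ : ℝ)
    (hc₁ : 0 ≤ c₁) (hc₂ : 0 ≤ c₂) (hc₃ : 0 ≤ c₃) (hc₄ : 0 ≤ c₄) (hc₅ : 0 ≤ c₅)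
    (hd₁ : 0 ≤ d₁) (hd₂ : 0 ≤ d₂) (hd₃ : 0 ≤ d₃) (hd₄ : 0 ≤ d₄) (hd₅ : 0 ≤ d₅)
    (hδ : 0 ≤ δ) (h2 : 0 ≤ Δ ^ 2 + 5 * Δ * δ + 2 * δ ^ 2) (h5 : 0 ≤ 4 * δ + Δ) :
    0 ≤ (Δ ^ 2 + 5 * Δ * δ + 2 * δ ^ 2) * (c₁ * c₂ * c₃ * c₄ * c₅)
      + δ * (4 * δ + Δ) * (d₁ * c₂ * c₃ * c₄ * c₅ + d₂ * c₁ * c₃ * c₄ * c₅ + d₃ * c₁ * c₂ * c₄ * c₅ + d₄ * c₁ * c₂ * c₃ * c₅ + d₅ * c₁ * c₂ * c₃ * c₄)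
      + δ ^ 2 * (d₁ * d₂ * c₃ * c₄ * c₅ + d₁ * d₃ * c₂ * c₄ * c₅ + d₁ * d₄ * c₂ * c₃ * c₅ + d₁ * d₅ * c₂ * c₃ * c₄ + d₂ * d₃ * c₁ * c₄ * c₅ + d₂ * d₄ * c₁ * c₃ * c₅ + d₂ * d₅ * c₁ * c₃ * c₄ + d₃ * d₄ * c₁ * c₂ * c₅ + d₃ * d₅ * c₁ * c₂ * c₄ + d₄ * d₅ * c₁ * c₂ * c₃) := by
  positivity

/-- Main case of `conjectureN_53_doublyOneSided_smallTilt`: `v₁ < v₃`. -/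
theorem smallTilt_main (A₁ A₂ A₃ A₄ A₅ B₁ B₂ B₃ u₁ u₂ u₃ u₄ u₅ v₁ v₂ v₃ : ℝ)
    (hA : A₁ + A₂ + A₃ + A₄ + A₅ = B₁ + B₂ + B₃) (hC : u₁ + u₂ + u₃ + u₄ + u₅ = v₁ + v₂ + v₃)
    (hP1 : (A₁ ^ 2 * u₁ + A₂ ^ 2 * u₂ + A₃ ^ 2 * u₃ + A₄ ^ 2 * u₄ + A₅ ^ 2 * u₅) - (B₁ ^ 2 * v₁ + B₂ ^ 2 * v₂ + B₃ ^ 2 * v₃) = 0)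
    (hP2 : (A₁ * u₁ ^ 2 + A₂ * u₂ ^ 2 + A₃ * u₃ ^ 2 + A₄ * u₄ ^ 2 + A₅ * u₅ ^ 2) - (B₁ * v₁ ^ 2 + B₂ * v₂ ^ 2 + B₃ * v₃ ^ 2) = 0)
    (hP4 : (u₁ ^ 3 + u₂ ^ 3 + u₃ ^ 3 + u₄ ^ 3 + u₅ ^ 3) - (v₁ ^ 3 + v₂ ^ 3 + v₃ ^ 3) = 0)
    (m₁₁ : |u₁ - v₁| ≤ A₁ - B₁) (m₂₁ : |u₂ - v₁| ≤ A₂ - B₁) (m₃₁ : |u₃ - v₁| ≤ A₃ - B₁) (m₄₁ : |u₄ - v₁| ≤ A₄ - B₁) (m₅₁ : |u₅ - v₁| ≤ A₅ - B₁)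
    (_m₁₂ : |u₁ - v₂| ≤ A₁ - B₂) (_m₂₂ : |u₂ - v₂| ≤ A₂ - B₂) (_m₃₂ : |u₃ - v₂| ≤ A₃ - B₂) (_m₄₂ : |u₄ - v₂| ≤ A₄ - B₂) (_m₅₂ : |u₅ - v₂| ≤ A₅ - B₂)
    (m₁₃ : |u₁ - v₃| ≤ A₁ - B₃) (m₂₃ : |u₂ - v₃| ≤ A₂ - B₃) (m₃₃ : |u₃ - v₃| ≤ A₃ - B₃) (m₄₃ : |u₄ - v₃| ≤ A₄ - B₃) (m₅₃ : |u₅ - v₃| ≤ A₅ - B₃)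
    (lo₁ : v₁ ≤ u₁) (lo₂ : v₁ ≤ u₂) (lo₃ : v₁ ≤ u₃) (lo₄ : v₁ ≤ u₄) (lo₅ : v₁ ≤ u₅)
    (hi₁ : u₁ ≤ v₃) (hi₂ : u₂ ≤ v₃) (hi₃ : u₃ ≤ v₃) (hi₄ : u₄ ≤ v₃) (hi₅ : u₅ ≤ v₃)
    (ht₁ : 0 ≤ (B₃ - B₁) ^ 2 - 5 * (B₃ - B₁) * (v₃ - v₁) + 2 * (v₃ - v₁) ^ 2)
    (ht₂ : 0 ≤ (B₃ - B₁) ^ 2 + 5 * (B₃ - B₁) * (v₃ - v₁) + 2 * (v₃ - v₁) ^ 2)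
    (ht₃ : |B₃ - B₁| ≤ 4 * (v₃ - v₁)) (hlt : v₁ < v₃) :
    0 ≤ (v₃ - v₁) ^ 3 * ((1 / 2) * ((A₁ ^ 2 + A₂ ^ 2 + A₃ ^ 2 + A₄ ^ 2 + A₅ ^ 2) - (B₁ ^ 2 + B₂ ^ 2 + B₃ ^ 2)) * ((u₁ ^ 2 + u₂ ^ 2 + u₃ ^ 2 + u₄ ^ 2 + u₅ ^ 2) - (v₁ ^ 2 + v₂ ^ 2 + v₃ ^ 2))
        + ((A₁ * u₁ + A₂ * u₂ + A₃ * u₃ + A₄ * u₄ + A₅ * u₅) - (B₁ * v₁ + B₂ * v₂ + B₃ * v₃)) ^ 2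
        - 3 * ((A₁ ^ 2 * u₁ ^ 2 + A₂ ^ 2 * u₂ ^ 2 + A₃ ^ 2 * u₃ ^ 2 + A₄ ^ 2 * u₄ ^ 2 + A₅ ^ 2 * u₅ ^ 2) - (B₁ ^ 2 * v₁ ^ 2 + B₂ ^ 2 * v₂ ^ 2 + B₃ ^ 2 * v₃ ^ 2))
      + (4 / 3) * (3 * ((u₁ ^ 4 + u₂ ^ 4 + u₃ ^ 4 + u₄ ^ 4 + u₅ ^ 4) - (v₁ ^ 4 + v₂ ^ 4 + v₃ ^ 4)) - (3 / 2) * ((u₁ ^ 2 + u₂ ^ 2 + u₃ ^ 2 + u₄ ^ 2 + u₅ ^ 2) - (v₁ ^ 2 + v₂ ^ 2 + v₃ ^ 2)) ^ 2)) := by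
  have hδ : 0 < v₃ - v₁ := by linarith
  have h4 : 0 ≤ 4 * (v₃ - v₁) - (B₃ - B₁) := by linarith [le_abs_self (B₃ - B₁)]
  have h5 : 0 ≤ 4 * (v₃ - v₁) + (B₃ - B₁) := by linarith [neg_abs_le (B₃ - B₁)]
  have kl := psi_low_nonneg (u₁ - v₁) (u₂ - v₁) (u₃ - v₁) (u₄ - v₁) (u₅ - v₁)
    ((A₁ - B₁) - (u₁ - v₁)) ((A₂ - B₁) - (u₂ - v₁)) ((A₃ - B₁) - (u₃ - v₁)) ((A₄ - B₁) - (u₄ - v₁)) ((A₅ - B₁) - (u₅ - v₁)) (v₃ - v₁) (B₃ - B₁)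
    (by linarith) (by linarith) (by linarith) (by linarith) (by linarith)
    (by linarith [le_abs_self (u₁ - v₁)]) (by linarith [le_abs_self (u₂ - v₁)]) (by linarith [le_abs_self (u₃ - v₁)])
    (by linarith [le_abs_self (u₄ - v₁)]) (by linarith [le_abs_self (u₅ - v₁)])
    hδ.le ht₁ h4
  have kh := psi_high_nonneg (v₃ - u₁) (v₃ - u₂) (v₃ - u₃) (v₃ - u₄) (v₃ - u₅)
    ((A₁ - B₃) - (v₃ - u₁)) ((A₂ - B₃) - (v₃ - u₂)) ((A₃ - B₃) - (v₃ - u₃)) ((A₄ - B₃) - (v₃ - u₄)) ((A₅ - B₃) - (v₃ - u₅)) (v₃ - v₁) (B₃ - B₁)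
    (by linarith) (by linarith) (by linarith) (by linarith) (by linarith)
    (by linarith [neg_abs_le (u₁ - v₃)]) (by linarith [neg_abs_le (u₂ - v₃)]) (by linarith [neg_abs_le (u₃ - v₃)])
    (by linarith [neg_abs_le (u₄ - v₃)]) (by linarith [neg_abs_le (u₅ - v₃)])
    hδ.le ht₂ h5
  -- Ψ(1) ≥ 0 ≥ Ψ(3), written against the K-expressions of `Glam_delta_cubed_13`
  have hlow : 0 ≤ (v₃ - v₁) ^ 2 * ((A₁ - B₁) * (A₂ - B₁) * (u₃ - v₁) * (u₄ - v₁) * (u₅ - v₁)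
        + (A₁ - B₁) * (A₃ - B₁) * (u₂ - v₁) * (u₄ - v₁) * (u₅ - v₁)
        + (A₁ - B₁) * (A₄ - B₁) * (u₂ - v₁) * (u₃ - v₁) * (u₅ - v₁)
        + (A₁ - B₁) * (A₅ - B₁) * (u₂ - v₁) * (u₃ - v₁) * (u₄ - v₁)
        + (A₂ - B₁) * (A₃ - B₁) * (u₁ - v₁) * (u₄ - v₁) * (u₅ - v₁)
        + (A₂ - B₁) * (A₄ - B₁) * (u₁ - v₁) * (u₃ - v₁) * (u₅ - v₁)
        + (A₂ - B₁) * (A₅ - B₁) * (u₁ - v₁) * (u₃ - v₁) * (u₄ - v₁)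
        + (A₃ - B₁) * (A₄ - B₁) * (u₁ - v₁) * (u₂ - v₁) * (u₅ - v₁)
        + (A₃ - B₁) * (A₅ - B₁) * (u₁ - v₁) * (u₂ - v₁) * (u₄ - v₁)
        + (A₄ - B₁) * (A₅ - B₁) * (u₁ - v₁) * (u₂ - v₁) * (u₃ - v₁))
      - (v₃ - v₁) * (B₃ - B₁) * ((A₁ - B₁) * (u₂ - v₁) * (u₃ - v₁) * (u₄ - v₁) * (u₅ - v₁) + (A₂ - B₁) * (u₁ - v₁) * (u₃ - v₁) * (u₄ - v₁) * (u₅ - v₁) + (A₃ - B₁) * (u₁ - v₁) * (u₂ - v₁) * (u₄ - v₁) * (u₅ - v₁) + (A₄ - B₁) * (u₁ - v₁) * (u₂ - v₁) * (u₃ - v₁) * (u₅ - v₁) + (A₅ - B₁) * (u₁ - v₁) * (u₂ - v₁) * (u₃ - v₁) * (u₄ - v₁))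
      + ((B₃ - B₁) ^ 2 - 6 * (4 / 3) * (v₃ - v₁) ^ 2) * ((u₁ - v₁) * (u₂ - v₁) * (u₃ - v₁) * (u₄ - v₁) * (u₅ - v₁)) := by
    linear_combination kl
  have hhigh : 0 ≤ -((v₃ - v₁) ^ 2 * ((A₁ - B₃) * (A₂ - B₃) * (u₃ - v₃) * (u₄ - v₃) * (u₅ - v₃)
        + (A₁ - B₃) * (A₃ - B₃) * (u₂ - v₃) * (u₄ - v₃) * (u₅ - v₃)
        + (A₁ - B₃) * (A₄ - B₃) * (u₂ - v₃) * (u₃ - v₃) * (u₅ - v₃)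
        + (A₁ - B₃) * (A₅ - B₃) * (u₂ - v₃) * (u₃ - v₃) * (u₄ - v₃)
        + (A₂ - B₃) * (A₃ - B₃) * (u₁ - v₃) * (u₄ - v₃) * (u₅ - v₃)
        + (A₂ - B₃) * (A₄ - B₃) * (u₁ - v₃) * (u₃ - v₃) * (u₅ - v₃)
        + (A₂ - B₃) * (A₅ - B₃) * (u₁ - v₃) * (u₃ - v₃) * (u₄ - v₃)
        + (A₃ - B₃) * (A₄ - B₃) * (u₁ - v₃) * (u₂ - v₃) * (u₅ - v₃)
        + (A₃ - B₃) * (A₅ - B₃) * (u₁ - v₃) * (u₂ - v₃) * (u₄ - v₃)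
        + (A₄ - B₃) * (A₅ - B₃) * (u₁ - v₃) * (u₂ - v₃) * (u₃ - v₃))
      - (v₃ - v₁) * (B₃ - B₁) * ((A₁ - B₃) * (u₂ - v₃) * (u₃ - v₃) * (u₄ - v₃) * (u₅ - v₃) + (A₂ - B₃) * (u₁ - v₃) * (u₃ - v₃) * (u₄ - v₃) * (u₅ - v₃) + (A₃ - B₃) * (u₁ - v₃) * (u₂ - v₃) * (u₄ - v₃) * (u₅ - v₃) + (A₄ - B₃) * (u₁ - v₃) * (u₂ - v₃) * (u₃ - v₃) * (u₅ - v₃) + (A₅ - B₃) * (u₁ - v₃) * (u₂ - v₃) * (u₃ - v₃) * (u₄ - v₃))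
      + ((B₃ - B₁) ^ 2 - 6 * (4 / 3) * (v₃ - v₁) ^ 2) * ((u₁ - v₃) * (u₂ - v₃) * (u₃ - v₃) * (u₄ - v₃) * (u₅ - v₃))) := by
    linear_combination kh
  clear kl kh h4 h5
  rw [Glam_delta_cubed_13 A₁ A₂ A₃ A₄ A₅ B₁ B₂ B₃ u₁ u₂ u₃ u₄ u₅ v₁ v₂ v₃ hA hC hP1 hP2 hP4 (4 / 3)]
  linarith [hlow, hhigh]

/-- **CONJECTURE N, FORMAT (5,3), DOUBLY-ONE-SIDED CLASS, SMALL TILT.** Centred + pure (P1, P2, P4) + pairwise ample, all E-charges between the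
charges of `F₁` and `F₃` (`v₁ ≤ u_e ≤ v₃`), and tilt `γ₁₃ = (B₃−B₁)/(v₃−v₁)` with `γ₁₃² − 5|γ₁₃| + 2 ≥ 0`, `|γ₁₃| ≤ 4` (i.e. `|γ₁₃| ≤ (5−√17)/2`,
written without division) ⟹ `Q₂ + (4/3)·Q₄ ≥ 0`. -/
theorem conjectureN_53_doublyOneSided_smallTilt (A₁ A₂ A₃ A₄ A₅ B₁ B₂ B₃ u₁ u₂ u₃ u₄ u₅ v₁ v₂ v₃ : ℝ)
    (hA : A₁ + A₂ + A₃ + A₄ + A₅ = B₁ + B₂ + B₃) (hC : u₁ + u₂ + u₃ + u₄ + u₅ = v₁ + v₂ + v₃)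
    (hP1 : (A₁ ^ 2 * u₁ + A₂ ^ 2 * u₂ + A₃ ^ 2 * u₃ + A₄ ^ 2 * u₄ + A₅ ^ 2 * u₅) - (B₁ ^ 2 * v₁ + B₂ ^ 2 * v₂ + B₃ ^ 2 * v₃) = 0)
    (hP2 : (A₁ * u₁ ^ 2 + A₂ * u₂ ^ 2 + A₃ * u₃ ^ 2 + A₄ * u₄ ^ 2 + A₅ * u₅ ^ 2) - (B₁ * v₁ ^ 2 + B₂ * v₂ ^ 2 + B₃ * v₃ ^ 2) = 0)
    (hP4 : (u₁ ^ 3 + u₂ ^ 3 + u₃ ^ 3 + u₄ ^ 3 + u₅ ^ 3) - (v₁ ^ 3 + v₂ ^ 3 + v₃ ^ 3) = 0)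
    (m₁₁ : |u₁ - v₁| ≤ A₁ - B₁) (m₂₁ : |u₂ - v₁| ≤ A₂ - B₁) (m₃₁ : |u₃ - v₁| ≤ A₃ - B₁) (m₄₁ : |u₄ - v₁| ≤ A₄ - B₁) (m₅₁ : |u₅ - v₁| ≤ A₅ - B₁)
    (m₁₂ : |u₁ - v₂| ≤ A₁ - B₂) (m₂₂ : |u₂ - v₂| ≤ A₂ - B₂) (m₃₂ : |u₃ - v₂| ≤ A₃ - B₂) (m₄₂ : |u₄ - v₂| ≤ A₄ - B₂) (m₅₂ : |u₅ - v₂| ≤ A₅ - B₂)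
    (m₁₃ : |u₁ - v₃| ≤ A₁ - B₃) (m₂₃ : |u₂ - v₃| ≤ A₂ - B₃) (m₃₃ : |u₃ - v₃| ≤ A₃ - B₃) (m₄₃ : |u₄ - v₃| ≤ A₄ - B₃) (m₅₃ : |u₅ - v₃| ≤ A₅ - B₃)
    (lo₁ : v₁ ≤ u₁) (lo₂ : v₁ ≤ u₂) (lo₃ : v₁ ≤ u₃) (lo₄ : v₁ ≤ u₄) (lo₅ : v₁ ≤ u₅)
    (hi₁ : u₁ ≤ v₃) (hi₂ : u₂ ≤ v₃) (hi₃ : u₃ ≤ v₃) (hi₄ : u₄ ≤ v₃) (hi₅ : u₅ ≤ v₃)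
    (ht₁ : 0 ≤ (B₃ - B₁) ^ 2 - 5 * (B₃ - B₁) * (v₃ - v₁) + 2 * (v₃ - v₁) ^ 2)
    (ht₂ : 0 ≤ (B₃ - B₁) ^ 2 + 5 * (B₃ - B₁) * (v₃ - v₁) + 2 * (v₃ - v₁) ^ 2)
    (ht₃ : |B₃ - B₁| ≤ 4 * (v₃ - v₁)) :
    0 ≤ (1 / 2) * ((A₁ ^ 2 + A₂ ^ 2 + A₃ ^ 2 + A₄ ^ 2 + A₅ ^ 2) - (B₁ ^ 2 + B₂ ^ 2 + B₃ ^ 2)) * ((u₁ ^ 2 + u₂ ^ 2 + u₃ ^ 2 + u₄ ^ 2 + u₅ ^ 2) - (v₁ ^ 2 + v₂ ^ 2 + v₃ ^ 2))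
        + ((A₁ * u₁ + A₂ * u₂ + A₃ * u₃ + A₄ * u₄ + A₅ * u₅) - (B₁ * v₁ + B₂ * v₂ + B₃ * v₃)) ^ 2
        - 3 * ((A₁ ^ 2 * u₁ ^ 2 + A₂ ^ 2 * u₂ ^ 2 + A₃ ^ 2 * u₃ ^ 2 + A₄ ^ 2 * u₄ ^ 2 + A₅ ^ 2 * u₅ ^ 2) - (B₁ ^ 2 * v₁ ^ 2 + B₂ ^ 2 * v₂ ^ 2 + B₃ ^ 2 * v₃ ^ 2))
      + (4 / 3) * (3 * ((u₁ ^ 4 + u₂ ^ 4 + u₃ ^ 4 + u₄ ^ 4 + u₅ ^ 4) - (v₁ ^ 4 + v₂ ^ 4 + v₃ ^ 4)) - (3 / 2) * ((u₁ ^ 2 + u₂ ^ 2 + u₃ ^ 2 + u₄ ^ 2 + u₅ ^ 2) - (v₁ ^ 2 + v₂ ^ 2 + v₃ ^ 2)) ^ 2) := by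
  have hδ0 : v₁ ≤ v₃ := le_trans lo₁ hi₁
  rcases eq_or_lt_of_le hδ0 with heq | hlt
  · -- degenerate: all charges coincide, then P4 + centring force them to vanish
    clear m₁₁ m₂₁ m₃₁ m₄₁ m₅₁ m₁₂ m₂₂ m₃₂ m₄₂ m₅₂ m₁₃ m₂₃ m₃₃ m₄₃ m₅₃ ht₁ ht₂ ht₃ hP1 hP2 hA
    have e₁ : u₁ = v₁ := le_antisymm (heq ▸ hi₁) lo₁
    have e₂ : u₂ = v₁ := le_antisymm (heq ▸ hi₂) lo₂
    have e₃ : u₃ = v₁ := le_antisymm (heq ▸ hi₃) lo₃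
    have e₄ : u₄ = v₁ := le_antisymm (heq ▸ hi₄) lo₄
    have e₅ : u₅ = v₁ := le_antisymm (heq ▸ hi₅) lo₅
    have ev₂ : v₂ = 3 * v₁ := by rw [e₁, e₂, e₃, e₄, e₅, ← heq] at hC; linarith
    have ev₁ : v₁ = 0 := by
      rw [e₁, e₂, e₃, e₄, e₅, ← heq, ev₂] at hP4
      have : v₁ ^ 3 = 0 := by ring_nf at hP4; linarith
      exact pow_eq_zero_iff (n := 3) (by norm_num) |>.mp this
    subst e₁ e₂ e₃ e₄ e₅
    rw [← heq, ev₂, ev₁]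
    ring_nf
    positivity
  · have hprod := smallTilt_main A₁ A₂ A₃ A₄ A₅ B₁ B₂ B₃ u₁ u₂ u₃ u₄ u₅ v₁ v₂ v₃ hA hC hP1 hP2 hP4
      m₁₁ m₂₁ m₃₁ m₄₁ m₅₁ m₁₂ m₂₂ m₃₂ m₄₂ m₅₂ m₁₃ m₂₃ m₃₃ m₄₃ m₅₃ lo₁ lo₂ lo₃ lo₄ lo₅ hi₁ hi₂ hi₃ hi₄ hi₅ ht₁ ht₂ ht₃ hlt
    have hpos : 0 < (v₃ - v₁) ^ 3 := pow_pos (by linarith) 3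
    exact (mul_nonneg_iff_of_pos_left hpos).mp hprod

end Summit.HodgeConjecture.HodgeConjecture.WeilClassTestFormatFiveThreeDoublyOneSided
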